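import Literature.AnabelianGeometry.EtaleTheta.ContH1
import Literature.AnabelianGeometry.EtaleTheta.ContH1Discrete
import HarnessLib

/-!
# Continuous `H¹`: functoriality in EQUIVARIANT ENDOMORPHISMS of the coefficients (support file for [EtTh] §1)

Neukirch–Schmidt–Wingberg, *Cohomology of Number Fields*, I §2 / II §7: `H¹(H, −)` is a functor in the
`H`-module [cite: NeukirchSchmidtWingberg2008, I §2 and II §7]. The tree's concrete carrier `ContH1 φ A H`
(abc-iut-L2-t1) has coefficient-change along INCLUSIONS `A ≤ A'` (`ContH1CoeffChange`, abc-iut-w4-d014) and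
reduction modulo `B ≤ A` (`ContH1Reduction`); this file adds the change along a continuous ENDOMORPHISM
`e : A →* A` commuting with the conjugation action through `φ` on `H` — in [EtTh] §1 the `Ẑ`-module structure of
`Δ_Θ ≅ Ẑ(1)` (`u`-th powers commute with the cyclotomic action): Prop. 1.5 (i)/(ii) "`F⁰/F¹ = Hom(Δ_Θ, Δ_Θ) =
Ẑ·log(Θ)`" needs the classes `u · η` for `u ∈ Ẑ`, not only `n · η`, `n ∈ ℤ` [cite: MochizukiEtTh2009, Prop 1.5 p.23].

* `ContH1.mapEndoCocycle`, `ContH1.mapEndo e he hcomm : ContH1 φ A H →* ContH1 φ A H` (post-composition with `e`),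
  `mapEndo_mk`, `res_mapEndo` (commutes with restriction), `mapEndo_id`, `mapEndo_comp`.
Elementary; nothing of [EtTh] asserted; no side taken on [IUTchIII] Cor. 3.12. Seat abc-iut-L2-t6 (gen 5), R78
value layer (Prop. 1.5 (ii) clause (a) at the semi-synthetic models: surjectivity of `res_{Δ_Θ}` via `z`-class
powers `z^u`).
-/

namespace Literature.AnabelianGeometry.EtaleTheta

open scoped IsMulCommutative

namespace ContH1

variable {G G' : Type*} [Group G] [TopologicalSpace G]
  [Group G'] [TopologicalSpace G'] [IsTopologicalGroup G']
  (φ : G →* G') (A : Subgroup G') [A.Normal] [IsMulCommutative A] (H : Subgroup G)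
  (e : A →* A) (he : Continuous e)
  (hcomm : ∀ g : G, g ∈ H → ∀ a : A, e (MulAut.conjNormal (φ g) a) = MulAut.conjNormal (φ g) (e a))

include hcomm in
/-- Post-composition of continuous cocycles with an equivariant continuous endomorphism of the coefficients.
[cite: NeukirchSchmidtWingberg2008, I §2 and II §7] -/
def mapEndoCocycle : contCocycles φ A H →* contCocycles φ A H where
  toFun f := ⟨fun h => e (f.1 h), he.comp f.2.1, fun g h => by
    show e (f.1 (g * h)) = e (f.1 g) * MulAut.conjNormal (φ (g : G)) (e (f.1 h))
    rw [f.2.2 g h, map_mul, hcomm g.1 g.2]⟩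
  map_one' := Subtype.ext (funext fun _ => by simp)
  map_mul' f₁ f₂ := Subtype.ext (funext fun h => by
    change e ((f₁.1 * f₂.1) h) = e (f₁.1 h) * e (f₂.1 h)
    rw [Pi.mul_apply, map_mul])

include hcomm in
/-- **`H¹(H, A) → H¹(H, A)` induced by an equivariant continuous endomorphism `e` of `A`** (coboundaries of `a` go
to coboundaries of `e a`). [cite: NeukirchSchmidtWingberg2008, I §2 and II §7] -/
noncomputable def mapEndo : ContH1 φ A H →* ContH1 φ A H :=
  QuotientGroup.map _ _ (mapEndoCocycle φ A H e he hcomm) (by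
    intro f hf
    obtain ⟨a, ha⟩ := (mem_contCoboundaries_iff _).mp (Subgroup.mem_subgroupOf.mp hf)
    refine Subgroup.mem_subgroupOf.mpr ((mem_contCoboundaries_iff _).mpr ⟨e a, ?_⟩)
    funext h
    have := congrFun ha h
    change e (f.1 h) = _
    rw [this, map_mul, map_inv, hcomm h.1 h.2])

/-- `mapEndo` on the class of a cocycle. [cite: NeukirchSchmidtWingberg2008, I §2 and II §7] -/
theorem mapEndo_mk (f : H → A) (hf : f ∈ contCocycles φ A H) :
    mapEndo φ A H e he hcomm (ContH1.mk f hf) =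
      ContH1.mk (fun h => e (f h)) (mapEndoCocycle φ A H e he hcomm ⟨f, hf⟩).2 := rfl

/-- `mapEndo` commutes with restriction. [cite: NeukirchSchmidtWingberg2008, I §2 and II §7] -/
theorem res_mapEndo {H₁ : Subgroup G} (hle : H₁ ≤ H) (x : ContH1 φ A H) :
    ContH1.res φ A hle (mapEndo φ A H e he hcomm x) =
      mapEndo φ A H₁ e he (fun g hg a => hcomm g (hle hg) a) (ContH1.res φ A hle x) := by
  induction x using QuotientGroup.induction_on with
  | H f => rfl

/-- `mapEndo id = id`. [cite: NeukirchSchmidtWingberg2008, I §2 and II §7] -/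
theorem mapEndo_id (x : ContH1 φ A H) :
    mapEndo φ A H (MonoidHom.id A) continuous_id (fun _ _ _ => rfl) x = x := by
  induction x using QuotientGroup.induction_on with
  | H f => rfl

/-- `mapEndo (e₂ ∘ e₁) = mapEndo e₂ ∘ mapEndo e₁`. [cite: NeukirchSchmidtWingberg2008, I §2 and II §7] -/
theorem mapEndo_comp (e₁ e₂ : A →* A) (he₁ : Continuous e₁) (he₂ : Continuous e₂)
    (h₁ : ∀ g : G, g ∈ H → ∀ a : A, e₁ (MulAut.conjNormal (φ g) a) = MulAut.conjNormal (φ g) (e₁ a))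
    (h₂ : ∀ g : G, g ∈ H → ∀ a : A, e₂ (MulAut.conjNormal (φ g) a) = MulAut.conjNormal (φ g) (e₂ a))
    (x : ContH1 φ A H) :
    mapEndo φ A H (e₂.comp e₁) (he₂.comp he₁) (fun g hg a => by rw [MonoidHom.comp_apply, h₁ g hg, h₂ g hg]; rfl) x =
      mapEndo φ A H e₂ he₂ h₂ (mapEndo φ A H e₁ he₁ h₁ x) := by
  induction x using QuotientGroup.induction_on with
  | H f => rfl

/-- The `n`-th power endomorphism of the commutative coefficients is the `n`-th power on `H¹` (consistency with
the group structure). [cite: NeukirchSchmidtWingberg2008, I §2 and II §7] -/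
theorem mapEndo_powMonoidHom (n : ℕ) (hc : Continuous (powMonoidHom n : A →* A)) (x : ContH1 φ A H) :
    mapEndo φ A H (powMonoidHom n) hc (fun g _ a => by simp [map_pow]) x = x ^ n := by
  induction x using QuotientGroup.induction_on with
  | H f => rfl

end ContH1

end Literature.AnabelianGeometry.EtaleTheta
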